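import Summits.QuantumFields.YangMills.Theorems.UnitScaleTiltHalvingP1FlatCoreTopTargetRep
import Summits.QuantumFields.YangMills.Theorems.UnitScaleTiltProp8ChartDoubleBarSU2
import HarnessLib

/-!
# Line H (`BirthV10.stub_halvingStep`, stmt-QuantumFields-19200), J4c (T4b) FILE 4, **READ-TERRITORY VARIANT** of ✓`P1FlatCoreTopTargetRep.exists_topTarget_of_axialT`
# — the target `th` of block (D) of ✓`P1FlatCoreTopStepTorus.hFP_kLevel_top_RD` when the field `W₁` is near `1` ∕ unitary ONLY ON THE BONDS READ BY THE AXIAL WALKS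
# (★w3-20520 g6's (D)-locality issue: the H-line's `W₁ = (U♯)^g` with the composite gauge is near `1` on the window only)

Cell `ym3-torus` (HUMAN RULING D-0037: YM₃ on T³ is ladder rung R3, NOT the Clay problem), width seat `ym-ust-19936-w8` gen 3 (★w3-20520 g6 15:38:58Z ask).
`--supports stmt-QuantumFields-19200 --as helper`; THEOREMS ONLY (0 `def`, 0 `sorry`); count-neutral; nothing here claims `core′`, `hSupU`, the stub, the crux or the gap.

WHAT.  ✓`exists_topTarget_of_axialT` asks `‖W₁(b) − 1‖ ≤ s₀` and `W₁(b) ∈ U(2)` at EVERY fine bond of the torus; it uses them only through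
✓`P1FlatCoreFrameLinStar.holT_dbarIterU_mem_unitaryGroup` to know that the axial transporters `v₀(W̿₁^{(k)}; y₀, π_k yc)` are unitary (skewness of their
logarithms, [Balaban1985Averaging] (23)).  Here the same conclusion from data on the READ TERRITORY only:
* §1 ★`axialT_dbarIterU_mem_unitaryGroup_of_reads` — for a set `S` of `k`-sites, a field `W₁` within `s₀` of `1` and unitary on the fine bonds whose `k`-blocks lie
  in `S` (`8·3800·((d+2)L)²·Lᵏ·s₀ ≤ 1`), and a target `x` whose comb `Γ_{y₀,x}` has all bond ends in `S`: `v₀(W̿₁^{(k)}; y₀, x) ∈ U(2)`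
  (✓`Prop8ChartDoubleBar.dbarIterU_mem_unitaryGroup_of_reads` on each comb bond + ✓`holT_pred_of_walk`);
* §2 ★`exists_topTarget_of_axialT_of_unitary` — ✓`exists_topTarget_of_axialT` with its two global rows REPLACED by the bare unitarity of the axial transporters
  on `Λ` (`haxU`), the form any territory argument plugs into; ★★`exists_topTarget_of_axialT_of_reads` — the same with `haxU` discharged by §1 from the
  read-territory rows (`hS`: the combs `Γ_{y₀,π_k yc}`, `yc ∈ Λ`, stay in `S` — for the H-line's member `S :=` the top cube, ✓`P1FlatCoreTopCubeWalks.walk_treeWord_subset_Om_top`).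
  Conclusions VERBATIM those of ✓p642293 (`th` skew, `th (k, yc) = log v₀(…)` on `Λ`, `0` below the top, `‖th‖ ≤ τ`); `norm_axialT_sub_one_lt_one` needs no variant.
HONEST SCOPE.  Bookkeeping; the smallness `hsmall` of the axial transporters and the geometry `hS` are the assembler's inputs.  Nothing of
[Balaban1985RegularSpaces] Prop. 5 ∕ Sect. E is proved here.

References: T. Bałaban, CMP **99** (1985) 75–102 [Balaban1985RegularSpaces] (Sect. E (1.91)–(1.92) p.98); CMP **98** (1985) 17–51 [Balaban1985Averaging]
((8)–(9) pp.18–19, (23) p.21, p.24); CMP **116** (1988) [Balaban1987RG1] ((0.9) p.253).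
-/

set_option autoImplicit false

noncomputable section

open scoped BigOperators Matrix.Norms.L2Operator

namespace Summit.QuantumFields.YangMills.Theorems.P1FlatCoreTopTargetRep

open Literature.MathematicalPhysics.QuantumFieldTheory.Balaban1983to89
open T4Continuum MatrixLog
open B14DomainGeom (Pt)
open Node00 (coverAt)
open B7Prop1Explicit (treeWord)
open B5Eq118OneStroke (iterBlockOf)
open B10Eq27TorusAxialLog (rel axialT holT)
open B8Eq1117Concrete (XSpace)
open ExpMeanLog (star_mlog_eq_neg)
open Summit.QuantumFields.YangMills.Theorems.Prop8ChartDoubleBar (dbarIterU dbarIterU_mem_unitaryGroup_of_reads holT_pred_of_walk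
  coe_units_inv_mem_unitaryGroup)
open Summit.QuantumFields.YangMills.Theorems.P1FlatCoreTopDictionary (exists_topTarget)

variable {P : Params}

/-! ## §1 The axial transporters of the double-bar top average are unitary from read-territory data -/

/-- ★ **`v₀(W̿₁^{(k)}; y₀, x) ∈ U(2)` FROM THE READ TERRITORY**: `W₁` within `s₀` of `1` and unitary on the fine bonds whose `k`-blocks lie in `S`
(`8·3800·((d+2)L)²·Lᵏ·s₀ ≤ 1`), every bond of the comb `Γ_{y₀,x}` with both ends in `S` ⇒ the axial transporter is unitary (each comb bond's double-bar variable
is unitary by ✓`dbarIterU_mem_unitaryGroup_of_reads`, products∕inverses by ✓`holT_pred_of_walk`). [cite: Balaban1985Averaging, (8)-(9) pp.18-19, p.24; Balaban1987RG1, (0.9) p.253] -/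
theorem axialT_dbarIterU_mem_unitaryGroup_of_reads {k : ℕ} (hk : k ≤ P.m + P.K) (S : Set (Site P k))
    (W₁ : GaugeField P 0 (Matrix (Fin 2) (Fin 2) ℂ)ˣ) {s₀ : ℝ} (hs₀ : 0 ≤ s₀)
    (hbudget : 8 * 3800 * (((P.d + 2) * P.L : ℕ) : ℝ) ^ 2 * (P.L : ℝ) ^ k * s₀ ≤ 1)
    (hW₁ : ∀ b : PBond P 0, iterBlockOf k b.src ∈ S → iterBlockOf k b.tgt ∈ S →
      ‖((W₁ b : (Matrix (Fin 2) (Fin 2) ℂ)ˣ) : Matrix (Fin 2) (Fin 2) ℂ) - 1‖ ≤ s₀)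
    (hWu : ∀ b : PBond P 0, iterBlockOf k b.src ∈ S → iterBlockOf k b.tgt ∈ S →
      ((W₁ b : (Matrix (Fin 2) (Fin 2) ℂ)ˣ) : Matrix (Fin 2) (Fin 2) ℂ) ∈ Matrix.unitaryGroup (Fin 2) ℂ)
    (y₀ x : Site P k) (hS : ∀ st ∈ walk y₀ (treeWord (rel y₀ x)), st.bond.src ∈ S ∧ st.bond.tgt ∈ S) :
    ((axialT (dbarIterU k W₁) y₀ x : (Matrix (Fin 2) (Fin 2) ℂ)ˣ) : Matrix (Fin 2) (Fin 2) ℂ) ∈ Matrix.unitaryGroup (Fin 2) ℂ := by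
  unfold axialT
  exact holT_pred_of_walk (fun u : (Matrix (Fin 2) (Fin 2) ℂ)ˣ => (u : Matrix (Fin 2) (Fin 2) ℂ) ∈ Matrix.unitaryGroup (Fin 2) ℂ)
    (by rw [Units.val_one]; exact Submonoid.one_mem _) (fun a b ha hb => by rw [Units.val_mul]; exact Submonoid.mul_mem _ ha hb)
    (fun a ha => coe_units_inv_mem_unitaryGroup ha) (dbarIterU k W₁) y₀ (treeWord (rel y₀ x)) fun st hst =>
    dbarIterU_mem_unitaryGroup_of_reads hk S W₁ hs₀ hbudget hW₁ hWu st.bond (hS st hst).1 (hS st hst).2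

/-! ## §2 The target of the top step from read-territory data -/

/-- ★ **THE TARGET OF THE TOP STEP FROM THE UNITARITY OF THE AXIAL TRANSPORTERS** — ✓`exists_topTarget_of_axialT` with its global rows `hW₁`∕`hWu`∕budget
replaced by `haxU : v₀(W̿₁^{(k)}; y₀, π_k yc) ∈ U(2)` on `Λ` (the only use they had); conclusion VERBATIM.
[cite: Balaban1985RegularSpaces, Sect. E (1.91)-(1.92) p.98; Balaban1985Averaging, (23) p.21, p.24] -/
theorem exists_topTarget_of_axialT_of_unitary {k : ℕ} (W₁ : GaugeField P 0 (Matrix (Fin 2) (Fin 2) ℂ)ˣ)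
    (y₀ : Site P k) (Λ : Set (Pt P.d)) {τ : ℝ} (hτ : 0 ≤ τ) (hτ3 : τ ≤ 2 / 3)
    (haxU : ∀ yc ∈ Λ, ((axialT (dbarIterU k W₁) y₀ (coverAt P k yc) : (Matrix (Fin 2) (Fin 2) ℂ)ˣ) : Matrix (Fin 2) (Fin 2) ℂ) ∈
      Matrix.unitaryGroup (Fin 2) ℂ)
    (hsmall : ∀ yc ∈ Λ, ‖((axialT (dbarIterU k W₁) y₀ (coverAt P k yc) : (Matrix (Fin 2) (Fin 2) ℂ)ˣ) : Matrix (Fin 2) (Fin 2) ℂ) - 1‖ ≤ τ / 2) :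
    ∃ th : XSpace P.d k (Matrix (Fin 2) (Fin 2) ℂ),
      (∀ p, star (th p) = -th p) ∧
      (∀ yc ∈ Λ, th (⟨k, Nat.lt_succ_self k⟩, yc) =
        mlog ((axialT (dbarIterU k W₁) y₀ (coverAt P k yc) : (Matrix (Fin 2) (Fin 2) ℂ)ˣ) : Matrix (Fin 2) (Fin 2) ℂ)) ∧
      (∀ (j : ℕ) (hj : j < k) (y : Pt P.d), th (⟨j, Nat.lt_succ_of_lt hj⟩, y) = 0) ∧
      ‖th‖ ≤ τ := by
  have ht : ∀ yc ∈ Λ, ‖mlog ((axialT (dbarIterU k W₁) y₀ (coverAt P k yc) : (Matrix (Fin 2) (Fin 2) ℂ)ˣ) : Matrix (Fin 2) (Fin 2) ℂ)‖ ≤ τ :=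
    fun yc hyc => (norm_mlog_le_two_mul ((hsmall yc hyc).trans (by linarith))).trans (by linarith [hsmall yc hyc])
  have hskew : ∀ yc ∈ Λ, star (mlog ((axialT (dbarIterU k W₁) y₀ (coverAt P k yc) : (Matrix (Fin 2) (Fin 2) ℂ)ˣ) : Matrix (Fin 2) (Fin 2) ℂ)) =
      -mlog ((axialT (dbarIterU k W₁) y₀ (coverAt P k yc) : (Matrix (Fin 2) (Fin 2) ℂ)ˣ) : Matrix (Fin 2) (Fin 2) ℂ) := fun yc hyc =>
    star_mlog_eq_neg (haxU yc hyc) ((hsmall yc hyc).trans (by linarith))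
  obtain ⟨th, h1, h2, _, h4, h5⟩ := exists_topTarget k Λ
    (fun yc => mlog ((axialT (dbarIterU k W₁) y₀ (coverAt P k yc) : (Matrix (Fin 2) (Fin 2) ℂ)ˣ) : Matrix (Fin 2) (Fin 2) ℂ)) hτ ht
  exact ⟨th, h5 hskew, h1, h2, h4⟩

/-- ★★ **THE TARGET OF THE TOP STEP FROM READ-TERRITORY DATA** — ✓`exists_topTarget_of_axialT` with `hW₁`∕`hWu` asked only on the fine bonds whose `k`-blocks lie in a
set `S` of `k`-sites containing both ends of every bond of the combs `Γ_{y₀,π_k yc}`, `yc ∈ Λ` (`hS`; for the H-line's member `S :=` the top cube and `hS` is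
✓`P1FlatCoreTopCubeWalks.walk_treeWord_subset_Om_top`); conclusion VERBATIM (`th` skew, `= log v₀(W̿₁^{(k)}; y₀, π_k yc)` on `Λ`, `0` below the top, `‖th‖ ≤ τ`).
[cite: Balaban1985RegularSpaces, Sect. E (1.91)-(1.92) p.98; Balaban1985Averaging, (8)-(9) pp.18-19, (23) p.21, p.24] -/
theorem exists_topTarget_of_axialT_of_reads {k : ℕ} (hk : k ≤ P.m + P.K) (S : Set (Site P k)) (W₁ : GaugeField P 0 (Matrix (Fin 2) (Fin 2) ℂ)ˣ)
    {s₀ : ℝ} (hs₀ : 0 ≤ s₀) (hbudget : 8 * 3800 * (((P.d + 2) * P.L : ℕ) : ℝ) ^ 2 * (P.L : ℝ) ^ k * s₀ ≤ 1)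
    (hW₁ : ∀ b : PBond P 0, iterBlockOf k b.src ∈ S → iterBlockOf k b.tgt ∈ S →
      ‖((W₁ b : (Matrix (Fin 2) (Fin 2) ℂ)ˣ) : Matrix (Fin 2) (Fin 2) ℂ) - 1‖ ≤ s₀)
    (hWu : ∀ b : PBond P 0, iterBlockOf k b.src ∈ S → iterBlockOf k b.tgt ∈ S →
      ((W₁ b : (Matrix (Fin 2) (Fin 2) ℂ)ˣ) : Matrix (Fin 2) (Fin 2) ℂ) ∈ Matrix.unitaryGroup (Fin 2) ℂ)
    (y₀ : Site P k) (Λ : Set (Pt P.d))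
    (hS : ∀ yc ∈ Λ, ∀ st ∈ walk y₀ (treeWord (rel y₀ (coverAt P k yc))), st.bond.src ∈ S ∧ st.bond.tgt ∈ S)
    {τ : ℝ} (hτ : 0 ≤ τ) (hτ3 : τ ≤ 2 / 3)
    (hsmall : ∀ yc ∈ Λ, ‖((axialT (dbarIterU k W₁) y₀ (coverAt P k yc) : (Matrix (Fin 2) (Fin 2) ℂ)ˣ) : Matrix (Fin 2) (Fin 2) ℂ) - 1‖ ≤ τ / 2) :
    ∃ th : XSpace P.d k (Matrix (Fin 2) (Fin 2) ℂ),
      (∀ p, star (th p) = -th p) ∧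
      (∀ yc ∈ Λ, th (⟨k, Nat.lt_succ_self k⟩, yc) =
        mlog ((axialT (dbarIterU k W₁) y₀ (coverAt P k yc) : (Matrix (Fin 2) (Fin 2) ℂ)ˣ) : Matrix (Fin 2) (Fin 2) ℂ)) ∧
      (∀ (j : ℕ) (hj : j < k) (y : Pt P.d), th (⟨j, Nat.lt_succ_of_lt hj⟩, y) = 0) ∧
      ‖th‖ ≤ τ :=
  exists_topTarget_of_axialT_of_unitary W₁ y₀ Λ hτ hτ3
    (fun yc hyc => axialT_dbarIterU_mem_unitaryGroup_of_reads hk S W₁ hs₀ hbudget hW₁ hWu y₀ (coverAt P k yc) (hS yc hyc)) hsmall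

end Summit.QuantumFields.YangMills.Theorems.P1FlatCoreTopTargetRep

end
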